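import Summits.ValiantsHypothesis.ValiantsHypothesis.Theorems.KPlusLogSqLawTropicalBParabolaCriterion
import Summits.ValiantsHypothesis.ValiantsHypothesis.Theorems.KPlusLogSqLawTropicalBTwoRowSharp
import Summits.ValiantsHypothesis.ValiantsHypothesis.Theorems.KPlusLogSqLawTropicalBTwoRowFamilyDefs
import Summits.ValiantsHypothesis.ValiantsHypothesis.Theorems.KPlusLogSqLawTropicalBTwoRowFamilySlopes

/-!
# Route «KPlusLogSqLaw», crux `TropicalB` (stmt-ValiantsHypothesis-19771) — the `m = 2` tropical row is EXACTLY `4K − 7`: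
# an explicit all-`K` family with `4K − 7` sign-alternating dominant breakpoints (objects in `…TropicalBTwoRowFamilyDefs`)

HONEST FRAMING.  Helper file (seat val-sym-trop-p4 (g2), cell `pub-symmetroid`, 2026-08-26).  A SMALL-FORMAT row (`m = 2`, every
`K ≥ 3`), far inside the crux's known regime; nothing on `TropicalB` in its window, `WeakLifting`, `MatrixDescartes`
(stmt-ValiantsHypothesis-18050) or VP ≠ VNP.  With `…TropicalBTwoRowSharp` (`T(2,K) ≤ 4K − 7`, p439570) this file makes the `m = 2`
tropical row EXACT for all `K ≥ 3`: `T(2, K) = 4K − 7` (the cell's records `4K − 7` were enumerated for `K ≤ 7` only,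
HOME/DATA-CUT-0823.md l.556).

THE FAMILY (`M = 4K²`, exponents `d_l = M·l + l²`).  The diagonal entries `(0,0)`, `(1,1)` carry all `K` classes, the off-diagonal
entries `(1,0)`, `(0,1)` carry the classes `1 … K−2` only.  Valuations put every intended chain term ON the parabola
`∑ v = slope²` and every other present term at depth `≥ 2M²` below it:
`v(0,0,a) = d_a²`, `v(1,1,b) = (d_{K−1} + d_b)² − d_{K−1}²`, `v(1,0,a) = (d_a + d_1)²`, `v(0,1,b) = (d_{K−2} + d_b)² − (d_{K−2} + d_1)²`.
The chain: identity terms along the HOOK `(a, 0)` (`a = 0…K−1`), `(K−1, b)` (`b = 1…K−1`) — total exponent ranks `0 … 2K−2` — and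
transposition terms along the INNER hook `(a, 1)` (`a = 1…K−2`), `(K−2, b)` (`b = 2…K−2`) — ranks `2 … 2K−4`; ordered by slope they
interleave as `A₀, A₁, B₂, A₂, B₃, A₃, …, B_{2K−4}, A_{2K−4}, A_{2K−3}, A_{2K−2}` (`4K − 6` terms), signs `(−1)^k` by the choice
`ε(0,0,0) = 1`, `ε(0,0,a) = −1 (a ≥ 1)`, `ε(1,1,K−2) = −1`, `ε(1,1,b) = 1` otherwise, `ε(1,0,·) = 1`, `ε(0,1,·) = −1` on `1…K−2`.
Dominance is the PARABOLA CRITERION (`isDominant_of_parabola`, p440741) with depth `D = 2M²` and gap bound `G = 6K²`.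

* `not_tropRootLawAt_two_sharp : 3 ≤ K → ¬ TropRootLawAt 2 K (4 * K - 8)`;
* `tropRootLawAt_two_iff : 3 ≤ K → (TropRootLawAt 2 K B ↔ 4 * K - 7 ≤ B)`.
[cell statement for `K ≤ 7`; the all-`K` family and its kernel proof are this seat's; folklore technique]
-/

set_option linter.dupNamespace false
set_option autoImplicit false

namespace Summit.ValiantsHypothesis.ValiantsHypothesis.Theorems.KPlusLogSqLaw

open Summit.ValiantsHypothesis.ValiantsHypothesis.Theorems.MatrixDescartes.Negative
open Summit.ValiantsHypothesis.ValiantsHypothesis.Theorems.LacunarySymmetroidMatrixDescartes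
open Summit.ValiantsHypothesis.ValiantsHypothesis.Theorems.LacunarySymmetroidMatrixDescartes.TropicalCensus
open Finset

namespace TwoRowFamily
/-! ## 6. The chain terms and the census objects -/


/-- the two permutations of `Fin 2`. -/
theorem perm_two : ∀ σ : Equiv.Perm (Fin 2), σ = 1 ∨ σ = Equiv.swap 0 1 := by decide

/-- the transposition of `Fin 2` is odd. -/
theorem sign_swap_two : Equiv.Perm.sign (Equiv.swap (0 : Fin 2) 1) = -1 := Equiv.Perm.sign_swap (by decide)

/-- slope of a `2 × 2` term. -/
theorem slope_two' (K : ℕ) (q : Equiv.Perm (Fin 2) × (Fin 2 → Fin K)) :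
    TropicalCensus.slope (dd K) q = ((dN K (q.2 0) : ℕ) : ℤ) + dN K (q.2 1) := by
  unfold TropicalCensus.slope dd; rw [Fin.sum_univ_two]

/-- value sum of a `2 × 2` term. -/
theorem val_two (K : ℕ) (q : Equiv.Perm (Fin 2) × (Fin 2 → Fin K)) :
    ∑ i, vv K (q.1 i) i (q.2 i) = vN K (q.1 0) 0 (q.2 0) + vN K (q.1 1) 1 (q.2 1) := by
  rw [Fin.sum_univ_two]; rfl

/-- sign of a `2 × 2` term. -/
theorem termSign_two (K : ℕ) (q : Equiv.Perm (Fin 2) × (Fin 2 → Fin K)) :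
    termSign (ee K) q = (Equiv.Perm.sign q.1 : ℤ) * (eN K (q.1 0) 0 (q.2 0) * eN K (q.1 1) 1 (q.2 1)) := by
  unfold termSign ee; rw [Fin.prod_univ_two]

/-- the permutation of chain term `k`. -/
theorem termN_fst (K : ℕ) (hK : 3 ≤ K) (k : ℕ) (hk : k ≤ 4 * K - 7) :
    (termN K hK k hk).1 = if 2 ≤ k ∧ k + 9 ≤ 4 * K ∧ k % 2 = 0 then Equiv.swap 0 1 else 1 := rfl

/-- the column-`0` class of chain term `k`. -/
theorem termN_snd_zero (K : ℕ) (hK : 3 ≤ K) (k : ℕ) (hk : k ≤ 4 * K - 7) :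
    (((termN K hK k hk).2 0 : Fin K) : ℕ) = ca K k := rfl

/-- the column-`1` class of chain term `k`. -/
theorem termN_snd_one (K : ℕ) (hK : 3 ≤ K) (k : ℕ) (hk : k ≤ 4 * K - 7) :
    (((termN K hK k hk).2 1 : Fin K) : ℕ) = cb K k := by
  have h : (termN K hK k hk).2 1 = ⟨cb K k, cb_lt K k hK hk⟩ := by
    show (if (1 : Fin 2) = 0 then (⟨ca K k, ca_lt K k hK⟩ : Fin K) else (⟨cb K k, cb_lt K k hK hk⟩ : Fin K)) = _
    rw [if_neg (show ¬ ((1 : Fin 2) = 0) by decide)]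
  rw [h]

/-- a term with the right permutation and classes IS the chain term. -/
theorem termN_eq (K : ℕ) (hK : 3 ≤ K) (k : ℕ) (hk : k ≤ 4 * K - 7) (q : Equiv.Perm (Fin 2) × (Fin 2 → Fin K))
    (hσ : q.1 = if 2 ≤ k ∧ k + 9 ≤ 4 * K ∧ k % 2 = 0 then Equiv.swap 0 1 else 1)
    (ha : ca K k = q.2 0) (hb : cb K k = q.2 1) : termN K hK k hk = q := by
  refine Prod.ext (by rw [termN_fst, hσ]) (funext fun i => ?_)
  apply Fin.ext
  fin_cases i
  · show (((termN K hK k hk).2 0 : Fin K) : ℕ) = ((q.2 0 : Fin K) : ℕ)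
    rw [termN_snd_zero]; exact ha
  · show (((termN K hK k hk).2 1 : Fin K) : ℕ) = ((q.2 1 : Fin K) : ℕ)
    rw [termN_snd_one]; exact hb

/-- slopes of the chain terms. -/
theorem slope_term (K : ℕ) (hK : 3 ≤ K) (k : Fin (nn K + 1)) : TropicalCensus.slope (dd K) (term K hK k) = xZ K k := by
  rw [slope_two']
  unfold term xZ xN
  rw [termN_snd_zero, termN_snd_one]
  push_cast; ring

/-- the chain terms lie ON the parabola `∑ v = slope²`. -/
theorem val_term (K : ℕ) (hK : 3 ≤ K) (k : Fin (nn K + 1)) :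
    ∑ i, vv K ((term K hK k).1 i) i ((term K hK k).2 i) = xZ K k ^ 2 + 0 := by
  rw [val_two, add_zero]
  have hk := le_of_fin K k
  have hx : xZ K k = ((dN K (ca K k) : ℕ) : ℤ) + dN K (cb K k) := by unfold xZ xN; push_cast; ring
  rw [hx]
  unfold term
  obtain ⟨hA, hB⟩ := classes_hook K k hK hk
  by_cases hc : 2 ≤ (k : ℕ) ∧ (k : ℕ) + 9 ≤ 4 * K ∧ (k : ℕ) % 2 = 0
  · have h1 : (termN K hK k hk).1 = Equiv.swap 0 1 := by rw [termN_fst, if_pos hc]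
    rw [h1, Equiv.swap_apply_left, Equiv.swap_apply_right]
    show vN K 1 0 (((termN K hK k hk).2 0 : Fin K) : ℕ) + vN K 0 1 (((termN K hK k hk).2 1 : Fin K) : ℕ) = _
    rw [termN_snd_zero, termN_snd_one]
    exact val_swap_hook K _ _ (hB hc).1
  · have h1 : (termN K hK k hk).1 = 1 := by rw [termN_fst, if_neg hc]
    rw [h1]
    show vN K ((1 : Equiv.Perm (Fin 2)) 0) 0 (((termN K hK k hk).2 0 : Fin K) : ℕ) +
      vN K ((1 : Equiv.Perm (Fin 2)) 1) 1 (((termN K hK k hk).2 1 : Fin K) : ℕ) = _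
    rw [termN_snd_zero, termN_snd_one, Equiv.Perm.coe_one, id_eq, id_eq]
    exact val_id_hook K _ _ (hA hc)

/-- the signs of the chain terms alternate with the parity of the index. -/
theorem termSign_term (K : ℕ) (hK : 3 ≤ K) (k : Fin (nn K + 1)) :
    termSign (ee K) (term K hK k) = if (k : ℕ) % 2 = 0 then 1 else -1 := by
  rw [termSign_two]
  have hk := le_of_fin K k
  unfold term
  obtain ⟨hA, hB⟩ := classes_hook K k hK hk
  by_cases hc : 2 ≤ (k : ℕ) ∧ (k : ℕ) + 9 ≤ 4 * K ∧ (k : ℕ) % 2 = 0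
  · have h1 : (termN K hK k hk).1 = Equiv.swap 0 1 := by rw [termN_fst, if_pos hc]
    rw [h1, sign_swap_two, Equiv.swap_apply_left, Equiv.swap_apply_right, if_pos hc.2.2]
    show ((-1 : ℤˣ) : ℤ) * (eN K 1 0 (((termN K hK k hk).2 0 : Fin K) : ℕ) * eN K 0 1 (((termN K hK k hk).2 1 : Fin K) : ℕ)) = 1
    rw [termN_snd_zero, termN_snd_one]
    obtain ⟨-, h1, h2, h3, h4⟩ := hB hc
    unfold eN
    simp only [one_ne_zero, if_false, if_true]
    rw [if_pos ⟨h1, h2⟩, if_pos ⟨h3, h4⟩]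
    norm_num
  · have h1 : (termN K hK k hk).1 = 1 := by rw [termN_fst, if_neg hc]
    rw [h1, Equiv.Perm.sign_one]
    show ((1 : ℤˣ) : ℤ) * (eN K ((1 : Equiv.Perm (Fin 2)) 0) 0 (((termN K hK k hk).2 0 : Fin K) : ℕ) *
      eN K ((1 : Equiv.Perm (Fin 2)) 1) 1 (((termN K hK k hk).2 1 : Fin K) : ℕ)) = _
    rw [termN_snd_zero, termN_snd_one, Equiv.Perm.coe_one, id_eq, id_eq]
    unfold eN
    simp only [one_ne_zero, if_false, if_true]
    rcases classes_parity K k hK hk hc with ⟨hpar, ⟨ha0, hb0⟩ | ⟨ha0, hb0⟩⟩ | ⟨hpar, ha0, hb0⟩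
    · rw [if_pos hpar, if_pos ha0, if_neg hb0]; norm_num
    · rw [if_pos hpar, if_neg ha0, if_pos hb0]; norm_num
    · rw [if_neg ha0, if_neg hb0, if_neg (show ¬ ((k : ℕ) % 2 = 0) by omega)]; norm_num

/-- the chain terms are present. -/
theorem termSign_term_ne_zero (K : ℕ) (hK : 3 ≤ K) (k : Fin (nn K + 1)) : termSign (ee K) (term K hK k) ≠ 0 := by
  rw [termSign_term]; split_ifs <;> norm_num

/-- consecutive chain terms have opposite signs. -/
theorem alt_term (K : ℕ) (hK : 3 ≤ K) (k : Fin (nn K)) :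
    termSign (ee K) (term K hK k.castSucc) * termSign (ee K) (term K hK k.succ) < 0 := by
  rw [termSign_term, termSign_term]
  simp only [Fin.val_succ, Fin.val_castSucc]
  by_cases h : (k : ℕ) % 2 = 0
  · rw [if_pos h, if_neg (by omega)]; norm_num
  · rw [if_neg h, if_pos (by omega)]; norm_num

/-- every present term off the chain lies at depth `≥ 2M²` below the parabola. -/
theorem val_off (K : ℕ) (hK : 3 ≤ K) (q : Equiv.Perm (Fin 2) × (Fin 2 → Fin K)) (hq : termSign (ee K) q ≠ 0)
    (hch : ∀ k, q ≠ term K hK k) :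
    TropicalCensus.slope (dd K) q ^ 2 + 0 + 2 * ((M K : ℕ) : ℤ) ^ 2 ≤ ∑ i, vv K (q.1 i) i (q.2 i) := by
  rw [slope_two', val_two, add_zero]
  rw [termSign_two] at hq
  have ha : ((q.2 0 : Fin K) : ℕ) < K := (q.2 0).isLt
  have hb : ((q.2 1 : Fin K) : ℕ) < K := (q.2 1).isLt
  rcases perm_two q.1 with hσ | hσ
  · -- identity term: off the hook, or it would be a chain term
    rw [hσ, Equiv.Perm.coe_one, id_eq, id_eq]
    by_cases hh : ((q.2 1 : Fin K) : ℕ) = 0 ∨ ((q.2 0 : Fin K) : ℕ) = K - 1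
    · exfalso
      obtain ⟨k, hk, hc, hca, hcb⟩ := exists_index_id K _ _ hK ha hb hh
      have hk' : k < nn K + 1 := by unfold nn; omega
      apply hch ⟨k, hk'⟩
      symm
      exact termN_eq K hK k _ q (by rw [hσ, if_neg hc]) hca hcb
    · push Not at hh
      exact val_id_off K _ _ hK (by omega) (by omega)
  · -- transposition term: present ⇒ classes in `[1, K−2]`; off the inner hook, or it would be a chain term
    rw [hσ, Equiv.swap_apply_left, Equiv.swap_apply_right] at hq ⊢
    have hpa : 1 ≤ ((q.2 0 : Fin K) : ℕ) ∧ ((q.2 0 : Fin K) : ℕ) + 2 ≤ K := by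
      by_contra hcon
      apply hq
      unfold eN; simp only [one_ne_zero, if_false, if_true]; rw [if_neg hcon]; ring
    have hpb : 1 ≤ ((q.2 1 : Fin K) : ℕ) ∧ ((q.2 1 : Fin K) : ℕ) + 2 ≤ K := by
      by_contra hcon
      apply hq
      unfold eN; simp only [one_ne_zero, if_false, if_true]; rw [if_neg hcon]; ring
    by_cases hh : ((q.2 1 : Fin K) : ℕ) = 1 ∨ ((q.2 0 : Fin K) : ℕ) = K - 2
    · exfalso
      obtain ⟨k, hk, hc, hca, hcb⟩ := exists_index_swap K _ _ hK hpa.1 hpa.2 hpb.1 hpb.2 hh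
      have hk' : k < nn K + 1 := by unfold nn; omega
      apply hch ⟨k, hk'⟩
      symm
      exact termN_eq K hK k _ q (by rw [hσ, if_pos hc]) hca hcb
    · push Not at hh
      exact val_swap_off K _ _ hK (by omega) (by omega)

end TwoRowFamily

open TwoRowFamily in
/-- **`T(2, K) ≥ 4K − 7`** for every `K ≥ 3`: the explicit family above has `4K − 7` sign-alternating dominant breakpoints, so the row
`TropRootLawAt 2 K (4K − 8)` fails. -/
theorem not_tropRootLawAt_two_sharp (K : ℕ) (hK : 3 ≤ K) : ¬ TropRootLawAt 2 K (4 * K - 8) := by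
  have hn : 4 * K - 8 < nn K := by unfold nn; omega
  have hMK : ((M K : ℕ) : ℤ) = 4 * (K : ℤ) ^ 2 := by unfold M; push_cast; ring
  have hK1 : (3 : ℤ) ≤ K := by exact_mod_cast hK
  refine tropRootLawAt_false_of_parabola (dd K) (vv K) (ee K) (term K hK) (xZ K) 0 (2 * ((M K : ℕ) : ℤ) ^ 2)
    (6 * (K : ℤ) ^ 2) (ee_natAbs K) (slope_term K hK) (xZ_strictMono K hK) (xZ_gap K hK) (termSign_term_ne_zero K hK)
    (val_term K hK) (val_off K hK) ?_ ?_ (alt_term K hK) hn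
  · rw [hMK]; positivity
  · rw [hMK]; nlinarith

/-- **The `m = 2` tropical row is exact: `T(2, K) = 4K − 7`** (`K ≥ 3`): `TropRootLawAt 2 K B ↔ 4K − 7 ≤ B`
(upper bound `tropRootLawAt_two_sharp`, lower bound `not_tropRootLawAt_two_sharp`). -/
theorem tropRootLawAt_two_iff (K : ℕ) (hK : 3 ≤ K) (B : ℕ) : TropRootLawAt 2 K B ↔ 4 * K - 7 ≤ B := by
  constructor
  · intro h
    by_contra hB
    exact not_tropRootLawAt_two_sharp K hK (tropRootLawAt_mono (by omega) h)
  · intro hB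
    exact tropRootLawAt_mono hB (tropRootLawAt_two_sharp K hK)


end Summit.ValiantsHypothesis.ValiantsHypothesis.Theorems.KPlusLogSqLaw
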